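/-
Copyright (c) 2026 the pub-hodgecm-mathlib formalisation cell (harness21).  Prover seat hodgecm-mathlib-LH5-p03 (g2): «D2⁺ NONNEG-POS DESCENT» — the export fix of ★ D2
`OrbitalDescentContinuous` for the (NONDEG-G′) brick of line LH3's organ J (LH3-plan (g3) RULINGS #6 (e)); 2026-09-02.
-/
import Literature.MeasureTheory.Group.OrbitalDescentContinuous     -- ★ p850135 D2 (F0P3a-p08 (g22)): `exists_descended_forall_orbitalIntegral_eq`; brings ★ `ConjugationCutoff`, ★ `OrbitalDescentCentralizer`, ★ `OrbitalDescentFunction`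
import Mathlib.MeasureTheory.Integral.Bochner.ContinuousLinearMap   -- `ContinuousLinearMap.integral_comp_comm` (real part through the integral)
import HarnessLib

/-!
# Harish-Chandra's descent PRESERVES NON-NEGATIVITY and NON-VANISHING at the base points — the export fix of ★ D2 `OrbitalDescentContinuous`

Topic `MeasureTheory/Group`; namespace `Literature.MeasureTheory.Group` (continues ★ `ConjugationCutoff`, ★ `OrbitalDescentCentralizer`, ★ `OrbitalDescentContinuous` of F0P3a-p08).
THEOREMS ONLY (no definition, no instance, no notation, no named fact, no `sorry`).  GENERIC topology ∕ measure theory on a locally compact group.  Cell `pub/hodgecm-mathlib`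
(D-0151), crux H413 = `stmt-HodgeConjecture-24833`, F0∕P3c line LH3 (closer stub `stub_N9`, organ J), brick (NONDEG-G′) (F0P3b-p01 (g15)): the organ J's proof needs ONE
test function `a′ ≥ 0` whose DESCENDED function `(a′)_M` is `≥ 0` AND NON-ZERO at the singular base point; ★ D2's head `exists_descended_forall_orbitalIntegral_eq` hides the
descended function behind `∃ ψM` and exports neither property (LH5-p03 (g2) census 07:49Z, LH3-plan (g3) RULINGS #6 (e) «= type the export fix»).  HONEST LABEL: HC_CM is proved
only modulo the 7 printed citations (2 remaining named inputs: hLiu418 = `stmt-HodgeConjecture-24832`, h413 = `stmt-HodgeConjecture-24833`) until rung 0 closes; count-neutral.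

THE MATHEMATICS.  `ψ_M(m) = ∫_G β(x) • ψ(x m x⁻¹) dν(x)` with Harish-Chandra's cut-off `β ≥ 0` of unit `M`-mass on `C·M` (★ `exists_continuous_hasCompactSupport_integral_comp_mul_eq_one`:
`β = β₀ ∕ max(B, δ)`, `β₀` Urysohn `= 1` on `C`).  (§1) The cut-off is moreover POSITIVE ON `C` (`β c = 1 ∕ B(c) > 0`) — one more exported conjunct of the same construction.
(§2) Since the compactness hypothesis `hCM` is monotone in `C`, one may take `1 ∈ C`, whence `β(1) > 0`; then for `ψ` REAL NON-NEGATIVE the descended `ψ_M` is real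
non-negative (the integrand is), and `ψ(m₀) > 0 ⇒ ψ_M(m₀) > 0` for EVERY `m₀ ∈ M` (the integrand `x ↦ β(x)·ψ(x m₀ x⁻¹)` is continuous, compactly supported, `≥ 0`, and `> 0` at
`x = 1`; a Haar measure is positive on open sets) — with the SAME descended function serving the orbital identity of ★ D2 at every base point `c(x)`, `x ∈ K`.

* `exists_continuous_hasCompactSupport_integral_comp_mul_eq_one_pos` — ★ cut-off + `∀ c ∈ C, 0 < β c`.
* **`exists_descended_nonneg_forall_orbitalIntegral_eq`** — ★ D2's head VERBATIM (same binders, same orbital identity) + «`ψ ≥ 0` real ⇒ `ψ_M ≥ 0` real» + «`ψ ≥ 0` real,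
  `ψ(m₀).re > 0` ⇒ `ψ_M(m₀).re > 0`» for every `m₀ : M`.

## References
* [HarishChandra1970] Harish-Chandra (notes by G. van Dijk), *Harmonic Analysis on Reductive p-adic Groups*, LNM 162 (1970), Part I §3 (proof of Lemma 19: the cut-off `β`;
  Lemmas 21–23: the descent).
* [Rogawski1990] J. D. Rogawski, *Automorphic Representations of Unitary Groups in Three Variables*, Ann. of Math. Stud. 123 (1990), §4.12 Lemma 4.12.1 p. 66; §8.2 p. 114.
* [Folland1995] G. B. Folland, *A Course in Abstract Harmonic Analysis* (1995), §2.6 Thm. 2.49.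
-/

set_option autoImplicit false

noncomputable section

open MeasureTheory MeasureTheory.Measure Topology Set Filter Function
open scoped Pointwise

namespace Literature.MeasureTheory.Group

/-! ## §1 The cut-off is positive on `C` -/

section Cutoff

variable {G : Type*} [Group G] [TopologicalSpace G] [IsTopologicalGroup G] [LocallyCompactSpace G] [SecondCountableTopology G] [T2Space G]
  (M : Subgroup G) (hM : IsClosed (M : Set G)) [MeasurableSpace M] [BorelSpace M]
  (ρ : Measure M) [ρ.IsMulLeftInvariant] [IsFiniteMeasureOnCompacts ρ]

include hM in
/-- **HARISH-CHANDRA'S CUT-OFF, POSITIVE ON `C`** (= ★ `exists_continuous_hasCompactSupport_integral_comp_mul_eq_one` with the extra conjunct `∀ c ∈ C, 0 < β c`, same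
construction): `M ≤ G` closed with a left Haar measure `ρ`, `C ⊆ G` compact ⇒ `β : G → ℝ` continuous, compactly supported, `≥ 0`, `> 0` on `C`, with `∫_M β(c k₀ k) dρ(k) = 1` for
`c ∈ C`, `k₀ ∈ M`.  `β = β₀ ∕ max(B, δ)` with `β₀` Urysohn `= 1` on `C`, `B` its fibre integral, `δ = min_C B > 0`, so `β(c) = 1 ∕ B(c) > 0` on `C`.
[cite: HarishChandra1970, Part I §3 (proof of Lemma 19)] -/
theorem exists_continuous_hasCompactSupport_integral_comp_mul_eq_one_pos [ρ.IsOpenPosMeasure] {C : Set G} (hC : IsCompact C) :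
    ∃ β : G → ℝ, Continuous β ∧ HasCompactSupport β ∧ (∀ g, 0 ≤ β g) ∧ (∀ c ∈ C, 0 < β c) ∧
      ∀ c ∈ C, ∀ k₀ : M, ∫ h : M, β (c * (k₀ : G) * (h : G)) ∂ρ = 1 := by
  classical
  -- Urysohn: `β₀ ∈ C_c(G)`, `0 ≤ β₀ ≤ 1`, `β₀ = 1` on `C`
  obtain ⟨β₀, hβ₀C, -, hβ₀s, hβ₀01⟩ := exists_continuous_one_zero_of_isCompact hC isClosed_empty (Set.disjoint_empty C)
  have hβ₀c : Continuous (β₀ : G → ℝ) := β₀.continuous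
  have hβ₀0 : ∀ g, 0 ≤ (β₀ : G → ℝ) g := fun g => (hβ₀01 g).1
  -- the fibre integral `B(x) = ∫_M β₀(x k) dρ(k)`
  set B : G → ℝ := fun x => ∫ h : M, (β₀ : G → ℝ) (x * (h : G)) ∂ρ with hBdef
  have hBc : Continuous B := by
    have h := continuous_fiberIntegral M ρ hM hβ₀c hβ₀s
    have hB' : B = fiberIntegral M ρ (β₀ : G → ℝ) ∘ (QuotientGroup.mk : G → G ⧸ M) := by
      funext x; simp only [hBdef, Function.comp_apply, fiberIntegral_mk]
    rw [hB']
    exact h.comp continuous_quot_mk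
  have hBk : ∀ (x : G) (k : M), B (x * (k : G)) = B x := fun x k => integral_comp_mul_mul_coe_eq M ρ (β₀ : G → ℝ) x k
  have hBpos : ∀ c ∈ C, 0 < B c := fun c hc => integral_comp_mul_coe_pos M hM ρ hβ₀c hβ₀s hβ₀0 (hβ₀C hc)
  -- `δ := min_C B > 0` (or `1` when `C = ∅`)
  obtain ⟨δ, hδ, hδB⟩ : ∃ δ : ℝ, 0 < δ ∧ ∀ c ∈ C, δ ≤ B c := by
    rcases C.eq_empty_or_nonempty with hCe | hCne
    · exact ⟨1, one_pos, fun c hc => by rw [hCe] at hc; exact absurd hc (Set.notMem_empty c)⟩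
    · obtain ⟨c₀, hc₀, hmin⟩ := hC.exists_isMinOn hCne hBc.continuousOn
      exact ⟨B c₀, hBpos c₀ hc₀, fun c hc => hmin hc⟩
  -- the cut-off
  refine ⟨fun g => (β₀ : G → ℝ) g / max (B g) δ, ?_, ?_, ?_, ?_, ?_⟩
  · exact hβ₀c.div (hBc.max continuous_const) fun g => (lt_max_of_lt_right hδ).ne'
  · refine hβ₀s.mono fun g hg => ?_
    rw [Function.mem_support] at hg ⊢
    intro h0
    exact hg (by rw [h0, zero_div])
  · exact fun g => div_nonneg (hβ₀0 g) ((hδ.le).trans (le_max_right _ _))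
  · intro c hc
    show 0 < (β₀ : G → ℝ) c / max (B c) δ
    have h1 : (β₀ : G → ℝ) c = 1 := hβ₀C hc
    rw [h1]
    exact div_pos one_pos (lt_max_of_lt_right hδ)
  · intro c hc k₀
    have hmax : ∀ h : M, max (B (c * (k₀ : G) * (h : G))) δ = B c := by
      intro h
      rw [mul_assoc, ← Subgroup.coe_mul, hBk, max_eq_left (hδB c hc)]
    simp_rw [hmax]
    rw [integral_div, integral_comp_mul_mul_coe_eq M ρ (β₀ : G → ℝ) c k₀]
    exact div_self (hBpos c hc).ne'

end Cutoff

/-! ## §2 Uniform descent with the sign and the non-vanishing exported -/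

section Uniform

variable {G : Type*} [Group G] [TopologicalSpace G] [IsTopologicalGroup G] [LocallyCompactSpace G] [SecondCountableTopology G]
  [T2Space G] [MeasurableSpace G] [BorelSpace G]

/-- **UNIFORM DESCENT NEAR A SEMI-REGULAR POINT, WITH SIGN AND NON-VANISHING** — ★ D2 `exists_descended_forall_orbitalIntegral_eq` VERBATIM (same binders, same orbital
identity `Φ^G(c(x), ψ; ν∕νT) = Φ^M(c(x), ψ_M; νM∕νT′)` for every `x ∈ K`) PLUS: if `ψ` is real-valued and non-negative (`0 ≤ re`, `im = 0`) then so is the descended `ψ_M`, and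
`ψ(m₀).re > 0 ⇒ ψ_M(m₀).re > 0` for EVERY `m₀ ∈ M`.  Proof: the SAME construction with the compact set `insert 1 C` (the hypothesis `hCM` is monotone in `C`) and the cut-off of
§1, which is then positive at `1`; `ψ_M(m₀).re = ∫ β(x)·ψ(x m₀ x⁻¹).re dν(x)` has a continuous, compactly supported, non-negative integrand, positive at `x = 1`, and a Haar measure
is positive on non-empty open sets. [cite: Rogawski1990, §4.12 Lemma 4.12.1 p. 66; §8.2 p. 114] [cite: HarishChandra1970, Part I §3 Lemmas 22–23] -/
theorem exists_descended_nonneg_forall_orbitalIntegral_eq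
    (ν : Measure G) [ν.IsHaarMeasure] [ν.IsMulRightInvariant]
    (M : Subgroup G) (hM : IsClosed (M : Set G))
    (νM : Measure M) [νM.IsHaarMeasure] [νM.IsMulRightInvariant] [νM.IsInvInvariant]
    {X : Type*} (c : X → M) {K : Set X}
    {ψ : G → ℂ} (hψc : Continuous ψ) (hψs : HasCompactSupport ψ)
    {C : Set G} (hC : IsCompact C) (hCM : ∀ x ∈ K, ∀ y : G, y * ((c x : M) : G) * y⁻¹ ∈ tsupport ψ → y ∈ C * (M : Set G)) :
    ∃ ψM : M → ℂ, Continuous ψM ∧ HasCompactSupport ψM ∧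
      ((∀ g, 0 ≤ (ψ g).re ∧ (ψ g).im = 0) → ∀ m, 0 ≤ (ψM m).re ∧ (ψM m).im = 0) ∧
      (∀ m₀ : M, (∀ g, 0 ≤ (ψ g).re ∧ (ψ g).im = 0) → 0 < (ψ (m₀ : G)).re → 0 < (ψM m₀).re) ∧
      ∀ x ∈ K,
        ∀ [hT : IsClosed ((Subgroup.centralizer ({((c x : M) : G)} : Set G) : Subgroup G) : Set G)]
          [hT' : IsClosed ((Subgroup.centralizer ({c x} : Set M) : Subgroup M) : Set M)]
          [MeasurableSpace (G ⧸ Subgroup.centralizer ({((c x : M) : G)} : Set G))] [BorelSpace (G ⧸ Subgroup.centralizer ({((c x : M) : G)} : Set G))]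
          [MeasurableSpace (M ⧸ Subgroup.centralizer ({c x} : Set M))] [BorelSpace (M ⧸ Subgroup.centralizer ({c x} : Set M))]
          (νT : Measure (Subgroup.centralizer ({((c x : M) : G)} : Set G))) [νT.IsHaarMeasure] [νT.IsMulRightInvariant] [νT.IsInvInvariant]
          (νT' : Measure (Subgroup.centralizer ({c x} : Set M))) [νT'.IsHaarMeasure] [νT'.IsInvInvariant],
          νT = Measure.map (fun s : Subgroup.centralizer ({c x} : Set M) =>
            (⟨((s : M) : G), Subgroup.mem_centralizer_singleton_iff.2 (by
              have h := Subgroup.mem_centralizer_singleton_iff.1 s.2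
              exact_mod_cast congrArg ((↑) : M → G) h)⟩ : Subgroup.centralizer ({((c x : M) : G)} : Set G))) νT' →
          IsClosed {g : G | ∃ y : G, y * ((c x : M) : G) * y⁻¹ = g} →
            Literature.NumberTheory.Automorphic.orbitalIntegral ((c x : M) : G) ψ
                (quotientMeasure (Subgroup.centralizer ({((c x : M) : G)} : Set G)) νT hT ν) =
              Literature.NumberTheory.Automorphic.orbitalIntegral (c x) ψM
                (quotientMeasure (Subgroup.centralizer ({c x} : Set M)) νT' hT' νM) := by
  -- the compact set `insert 1 C` serves as well (`hCM` is monotone in `C`), and puts `1` where the cut-off is positive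
  have hC1 : IsCompact (insert (1 : G) C) := hC.insert 1
  have hCM1 : ∀ x ∈ K, ∀ y : G, y * ((c x : M) : G) * y⁻¹ ∈ tsupport ψ → y ∈ insert (1 : G) C * (M : Set G) := fun x hx y hy =>
    Set.mul_subset_mul_right (Set.subset_insert _ _) (hCM x hx y hy)
  -- ONE cut-off `β` of unit `M`-mass on `(insert 1 C) · M`, positive at `1`
  obtain ⟨β, hβc, hβs, hβ0, hβpos, hβ1⟩ := exists_continuous_hasCompactSupport_integral_comp_mul_eq_one_pos M hM νM hC1
  have hβone : 0 < β 1 := hβpos 1 (Set.mem_insert _ _)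
  -- the descended function and its integrand
  have hconj : ∀ m : G, Continuous fun x : G => x * m * x⁻¹ := fun m => (continuous_id.mul continuous_const).mul continuous_id.inv
  have hint : ∀ m : G, Integrable (fun x : G => β x • ψ (x * m * x⁻¹)) ν := fun m =>
    ((hβc.smul (hψc.comp (hconj m))).integrable_of_hasCompactSupport (hβs.smul_right))
  have hre : ∀ m : G, (∫ x, β x • ψ (x * m * x⁻¹) ∂ν).re = ∫ x, β x * (ψ (x * m * x⁻¹)).re ∂ν := fun m => by
    have h := (Complex.reCLM.integral_comp_comm (hint m)).symm
    simp only [Complex.reCLM_apply] at h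
    rw [h]
    refine integral_congr_ae (Eventually.of_forall fun x => ?_)
    simp only [Complex.smul_re, smul_eq_mul]
  have him : ∀ m : G, (∫ x, β x • ψ (x * m * x⁻¹) ∂ν).im = ∫ x, β x * (ψ (x * m * x⁻¹)).im ∂ν := fun m => by
    have h := (Complex.imCLM.integral_comp_comm (hint m)).symm
    simp only [Complex.imCLM_apply] at h
    rw [h]
    refine integral_congr_ae (Eventually.of_forall fun x => ?_)
    simp only [Complex.smul_im, smul_eq_mul]
  refine ⟨fun m : M => ∫ x, β x • ψ (x * (m : G) * x⁻¹) ∂ν, continuous_integral_conj_subtype ν M hβc hβs hψc,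
    hasCompactSupport_integral_conj ν M hM hβs hψs, ?_, ?_, ?_⟩
  · -- sign: real and non-negative
    intro hψ0 m
    refine ⟨?_, ?_⟩
    · rw [hre]
      exact integral_nonneg fun x => mul_nonneg (hβ0 x) (hψ0 _).1
    · rw [him]
      simp only [(hψ0 _).2, mul_zero, integral_zero]
  · -- non-vanishing at a base point `m₀` with `ψ(m₀) > 0`
    intro m₀ hψ0 hm₀
    rw [hre]
    refine Continuous.integral_pos_of_hasCompactSupport_nonneg_nonzero (x := (1 : G)) (hβc.mul (Complex.continuous_re.comp (hψc.comp (hconj _))))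
      ?_ (fun x => mul_nonneg (hβ0 x) (hψ0 _).1) ?_
    · exact hβs.mul_right
    · simp only [one_mul, inv_one, mul_one]
      exact (mul_pos hβone hm₀).ne'
  · intro x hx hT hT' _ _ _ _ νT _ _ _ νT' _ _ hνT hO
    exact orbitalIntegral_eq_orbitalIntegral_descended ν M hM νM (c x) νT νT' hνT hO hβc hβs hβ0 hβ1 hψc hψs (hCM1 x hx)

end Uniform

end Literature.MeasureTheory.Group

end
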